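import Mathlib.Analysis.SpecialFunctions.Pow.Real
import Mathlib.Analysis.SpecialFunctions.Sqrt
import Mathlib.Analysis.Convex.SpecificFunctions.Pow

/-!
# `PolycrystalWulffBound`, lane P: the near-twin reduction with the SHARP concavity constant
# `2 − 2^{2/3}` (helper for crux `stmt-Ventures-19482`; poly-p2 g22; memo C1-COST-g21 §7.1)

Route `StickyWulffConstant` of the venture `Summits/Ventures/Crystal3D`, second prover lane.  The arithmetic
core `nearTwin_arith` (p746232, `…NearTwinArith`) of the near-twin reduction splits off the smaller grain
with the Bernoulli constant `2/3` (`(a + b)^{2/3} ≤ a^{2/3} + (2/3)·b^{2/3}`), which gives the support-gap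
threshold `2(2√5 − 1)ε ≤ √3/3` (`ε ≤ 0.0831`, misorientations within `2.13°` of the twin).  The paper
version (C1-COST-g21 §7.1) uses the SHARP constant: for `0 ≤ b ≤ a`,

  `(a + b)^{2/3} ≤ a^{2/3} + (2^{2/3} − 1)·b^{2/3}`            (`rpow_two_thirds_add_le_sharp`),

with equality at `a = b` (`min_{t ≤ 1/2} [(1−t)^{2/3} + t^{2/3} − 1]/t^{2/3} = 2 − 2^{2/3}`, attained at
`t = ½`); it is the two-point concavity inequality of `x ↦ x^{2/3}` on `[0, ∞)` at the nodes `0, ½` and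
`1, ½` (Mathlib's `Real.strictConcaveOn_rpow`).  With it the reduction reaches the paper threshold

  `2(2√5 − 1)·ε ≤ √3·(2 − 2^{2/3})`   (`ε ≤ 0.1029`, every misorientation within `2.64°` of the twin)

(`nearTwin_arith_sharp`, same hypotheses as `nearTwin_arith` otherwise).
WHAT THIS IS NOT: geometry; nothing on the crux beyond the arithmetic; rung F-C1 not moved.
-/

noncomputable section

namespace Summit.Ventures.Crystal3D.Theorems

/-- **Sharp two-thirds splitting bound.**  For `0 ≤ b ≤ a`:
`(a + b)^{2/3} ≤ a^{2/3} + (2^{2/3} − 1)·b^{2/3}` (equality at `a = b`).  Proof: with `V = a + b`,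
`t = b/V ∈ [0, ½]`, concavity of `x ↦ x^{2/3}` between the nodes `0, ½` and `1, ½` with weights
`1 − 2t, 2t` gives `t^{2/3} ≥ 2t·(½)^{2/3}` and `(1 − t)^{2/3} ≥ (1 − 2t) + 2t·(½)^{2/3}`, whence
`(1 − t)^{2/3} + (2^{2/3} − 1)·t^{2/3} ≥ (1 − 2t) + 2t·(½)^{2/3}·2^{2/3} = 1`; scale by `V^{2/3}`. -/
theorem rpow_two_thirds_add_le_sharp {a b : ℝ} (hb : 0 ≤ b) (hba : b ≤ a) :
    (a + b) ^ ((2 : ℝ) / 3) ≤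
      a ^ ((2 : ℝ) / 3) + ((2 : ℝ) ^ ((2 : ℝ) / 3) - 1) * b ^ ((2 : ℝ) / 3) := by
  have ha : 0 ≤ a := hb.trans hba
  set p : ℝ := (2 : ℝ) / 3 with hp
  have hp0 : 0 < p := by rw [hp]; norm_num
  have hp1 : p < 1 := by rw [hp]; norm_num
  have hconc := (Real.strictConcaveOn_rpow hp0 hp1).concaveOn
  rcases (add_nonneg ha hb).eq_or_lt with hV | hV
  · -- `a + b = 0`, so `a = b = 0`
    have ha0 : a = 0 := by linarith
    have hb0 : b = 0 := by linarith
    rw [← hV, ha0, hb0, Real.zero_rpow hp0.ne', mul_zero, add_zero]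
  set V : ℝ := a + b with hVdef
  have hV0 : V ≠ 0 := hV.ne'
  set t : ℝ := b / V with ht
  have ht0 : 0 ≤ t := div_nonneg hb hV.le
  have ht2 : 2 * t ≤ 1 := by
    have h2 : 2 * t = (2 * b) / V := by rw [ht]; ring
    rw [h2, div_le_one hV, hVdef]
    linarith
  have h12 : 0 ≤ 1 - 2 * t := by linarith
  have h2t : 0 ≤ 2 * t := by linarith
  have hsum : (1 - 2 * t) + 2 * t = 1 := by ring
  -- the two-point concavity inequalities at the nodes `0, ½` and `1, ½`
  have h1 := hconc.2 (Set.mem_Ici.2 (le_refl (0 : ℝ))) (Set.mem_Ici.2 (by norm_num : (0 : ℝ) ≤ 1 / 2))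
    h12 h2t hsum
  have h2 := hconc.2 (Set.mem_Ici.2 (zero_le_one : (0 : ℝ) ≤ 1))
    (Set.mem_Ici.2 (by norm_num : (0 : ℝ) ≤ 1 / 2)) h12 h2t hsum
  simp only [smul_eq_mul, mul_zero, zero_add, mul_one, Real.zero_rpow hp0.ne', Real.one_rpow] at h1 h2
  have e1 : 2 * t * (1 / 2 : ℝ) = t := by ring
  have e2 : (1 - 2 * t) + 2 * t * (1 / 2 : ℝ) = 1 - t := by ring
  rw [e1] at h1
  rw [e2] at h2
  -- `(½)^p · 2^p = 1`
  have hhalf : (1 / 2 : ℝ) ^ p * (2 : ℝ) ^ p = 1 := by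
    rw [← Real.mul_rpow (by norm_num) (by norm_num)]
    norm_num
  have h2p : 0 ≤ (2 : ℝ) ^ p - 1 := by
    have : (1 : ℝ) ≤ 2 ^ p := Real.one_le_rpow (by norm_num) hp0.le
    linarith
  -- `(1 − t)^p + (2^p − 1)·t^p ≥ 1`
  have hkey : 1 ≤ (1 - t) ^ p + ((2 : ℝ) ^ p - 1) * t ^ p := by
    have h3 : ((2 : ℝ) ^ p - 1) * (2 * t * (1 / 2) ^ p) ≤ ((2 : ℝ) ^ p - 1) * t ^ p :=
      mul_le_mul_of_nonneg_left h1 h2p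
    have h4 : (1 - 2 * t) + 2 * t * (1 / 2 : ℝ) ^ p + ((2 : ℝ) ^ p - 1) * (2 * t * (1 / 2) ^ p) = 1 := by
      linear_combination (2 * t) * hhalf
    linarith
  -- scale by `V^p`
  have htV : t * V = b := by
    rw [ht]; field_simp
  have haV : a = (1 - t) * V := by
    rw [sub_mul, one_mul, htV, hVdef]; ring
  have hbV : b = t * V := htV.symm
  have h1t : 0 ≤ 1 - t := by linarith
  calc V ^ p = 1 * V ^ p := (one_mul _).symm
    _ ≤ ((1 - t) ^ p + ((2 : ℝ) ^ p - 1) * t ^ p) * V ^ p :=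
        mul_le_mul_of_nonneg_right hkey (Real.rpow_nonneg hV.le _)
    _ = ((1 - t) * V) ^ p + ((2 : ℝ) ^ p - 1) * (t * V) ^ p := by
        rw [Real.mul_rpow h1t hV.le, Real.mul_rpow ht0 hV.le]; ring
    _ = a ^ p + ((2 : ℝ) ^ p - 1) * b ^ p := by rw [← haV, ← hbV]

/-- `2^{2/3} ≤ 2`, so the sharp splitting constant `2^{2/3} − 1` is at most `1` and the saving
`2 − 2^{2/3}` is nonnegative. -/
theorem two_rpow_two_thirds_le_two : (2 : ℝ) ^ ((2 : ℝ) / 3) ≤ 2 := by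
  have h := Real.rpow_le_rpow_of_exponent_le (x := (2 : ℝ)) (by norm_num)
    (show (2 : ℝ) / 3 ≤ 1 by norm_num)
  rwa [Real.rpow_one] at h

/-- **Near-twin reduction, arithmetic core with the SHARP constant** (C1-COST-g21 §7.1).  The reals are
those of `nearTwin_arith`: `E` (energy of the generic pair at `c ≥ 1`), `Es` (energy of the same sets for
the twin pair at charge `½`), `P₁, P₂` (the two anisotropic perimeters), `J` (interface area), `F`
(exposed area of the smaller grain), `ε` (support gap), `w(v) = κ·v^{2/3}`.  IF `Es + J/2 − εF ≤ E`,
`w(v₁ + v₂) ≤ Es`, `P₁ + P₂ − (2√5 − 1)J ≤ E`, `w(v_i) ≤ P_i`, `√3·F ≤ P₂`, `0 ≤ v₂ ≤ v₁` and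
`2(2√5 − 1)·ε ≤ √3·(2 − 2^{2/3})` (i.e. `ε ≤ 0.1029`, every misorientation within `2.64°` of the twin),
THEN `w(v₁ + v₂) ≤ E`.  Case 2 (`J < 2εF`): `(2√5 − 1)J ≤ (2 − 2^{2/3})·P₂`, so
`E ≥ P₁ + (2^{2/3} − 1)P₂ ≥ κ(v₁^{2/3} + (2^{2/3} − 1)v₂^{2/3}) ≥ κ(v₁ + v₂)^{2/3}` by
`rpow_two_thirds_add_le_sharp`. -/
theorem nearTwin_arith_sharp {E Es P₁ P₂ J F v₁ v₂ ε κ : ℝ} (hκ : 0 ≤ κ) (hv₂ : 0 ≤ v₂) (h21 : v₂ ≤ v₁)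
    (hεmax : 2 * (2 * Real.sqrt 5 - 1) * ε ≤ Real.sqrt 3 * (2 - (2 : ℝ) ^ ((2 : ℝ) / 3))) (hF : 0 ≤ F)
    (h1 : Es + J / 2 - ε * F ≤ E) (h2 : κ * (v₁ + v₂) ^ ((2 : ℝ) / 3) ≤ Es)
    (h3 : P₁ + P₂ - (2 * Real.sqrt 5 - 1) * J ≤ E)
    (h4 : κ * v₁ ^ ((2 : ℝ) / 3) ≤ P₁) (h5 : κ * v₂ ^ ((2 : ℝ) / 3) ≤ P₂) (h6 : Real.sqrt 3 * F ≤ P₂) :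
    κ * (v₁ + v₂) ^ ((2 : ℝ) / 3) ≤ E := by
  have h3pos : 0 < Real.sqrt 3 := Real.sqrt_pos.2 (by norm_num)
  have h5ge : (1 : ℝ) ≤ 2 * Real.sqrt 5 - 1 := by
    have : (1 : ℝ) ≤ Real.sqrt 5 := by
      rw [show (1 : ℝ) = Real.sqrt 1 by rw [Real.sqrt_one]]
      exact Real.sqrt_le_sqrt (by norm_num)
    linarith
  have hq : 0 ≤ 2 - (2 : ℝ) ^ ((2 : ℝ) / 3) := by linarith [two_rpow_two_thirds_le_two]
  by_cases hcase : ε * F ≤ J / 2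
  · -- Case 1: the twin inequality pays
    linarith
  · -- Case 2: the interface is small against the exposed area of the smaller grain
    push Not at hcase
    have hJ : J < 2 * ε * F := by linarith
    have hP₂ : 0 ≤ P₂ := le_trans (mul_nonneg h3pos.le hF) h6
    -- `(2√5 − 1) J ≤ (2√5 − 1) · 2εF`
    have hA : (2 * Real.sqrt 5 - 1) * J ≤ (2 * Real.sqrt 5 - 1) * (2 * ε * F) :=
      mul_le_mul_of_nonneg_left hJ.le (le_trans zero_le_one h5ge)
    -- `(2√5 − 1)·2ε·F ≤ √3(2 − 2^{2/3})·F ≤ (2 − 2^{2/3})·P₂`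
    have hB : (2 * Real.sqrt 5 - 1) * (2 * ε * F) ≤ Real.sqrt 3 * (2 - (2 : ℝ) ^ ((2 : ℝ) / 3)) * F := by
      have : (2 * Real.sqrt 5 - 1) * (2 * ε * F) = (2 * (2 * Real.sqrt 5 - 1) * ε) * F := by ring
      rw [this]
      exact mul_le_mul_of_nonneg_right hεmax hF
    have hC : Real.sqrt 3 * (2 - (2 : ℝ) ^ ((2 : ℝ) / 3)) * F ≤ (2 - (2 : ℝ) ^ ((2 : ℝ) / 3)) * P₂ := by
      have : Real.sqrt 3 * (2 - (2 : ℝ) ^ ((2 : ℝ) / 3)) * F =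
          (2 - (2 : ℝ) ^ ((2 : ℝ) / 3)) * (Real.sqrt 3 * F) := by ring
      rw [this]
      exact mul_le_mul_of_nonneg_left h6 hq
    have hE : P₁ + ((2 : ℝ) ^ ((2 : ℝ) / 3) - 1) * P₂ ≤ E := by linarith
    have hsplit := rpow_two_thirds_add_le_sharp hv₂ h21
    have hk : 0 ≤ (2 : ℝ) ^ ((2 : ℝ) / 3) - 1 := by
      have : (1 : ℝ) ≤ 2 ^ ((2 : ℝ) / 3) := Real.one_le_rpow (by norm_num) (by norm_num)
      linarith
    calc κ * (v₁ + v₂) ^ ((2 : ℝ) / 3)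
        ≤ κ * (v₁ ^ ((2 : ℝ) / 3) + ((2 : ℝ) ^ ((2 : ℝ) / 3) - 1) * v₂ ^ ((2 : ℝ) / 3)) :=
          mul_le_mul_of_nonneg_left hsplit hκ
      _ = κ * v₁ ^ ((2 : ℝ) / 3) + ((2 : ℝ) ^ ((2 : ℝ) / 3) - 1) * (κ * v₂ ^ ((2 : ℝ) / 3)) := by ring
      _ ≤ P₁ + ((2 : ℝ) ^ ((2 : ℝ) / 3) - 1) * P₂ := by gcongr
      _ ≤ E := hE

end Summit.Ventures.Crystal3D.Theorems

end
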